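import Literature.NumberTheory.Automorphic.HeckeAlgebraOfTypeSigma
import HarnessLib

/-!
# Stub ideas for `stub_liftThree` — ideator k2 (HOME: RESHAPE), generation 8

Companion to `STUB-IDEAS-stub_liftThree-2.md` (crux `FreyModularity`, item `stmt-ABC-11340`,
route `ABC/DefiniteXi`).  Generation 7 (`StubIdeas2g7`) typed the Σ-step of Wiles' `R_Σ = T_Σ` in
COUNT form and left its Hecke half — DDT Thm. 3.36 `η_Σ' ⊆ π(c_q) η_Σ` (Ihara) — as ONE
named-fact-size Prop `IharaEtaStep`.  Generation 8 reshapes THAT step: following Wiles' direct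
argument (Annals 141, Prop. 2.4/2.6 pp. 495–496; DDT §4.4 pp. 125–127 and p. 133, Lemma 4.17,
Cor. 4.19, Lemma 4.24, Remark 4.25) the inclusion is an identity between VALUES OF A PAIRING on a
self-dual rank-2 Hecke module, and splits into elementwise bricks over the tree's
`Literature.RingTheory.CompleteIntersection.congruenceIdeal`:

* A≥  `pairing_mem_congruenceIdeal`      `⟨x, y⟩ ∈ η`  for `x ∈ Ann(℘)·L`, `y ∈ L[℘]`       (XS)
* A0  `kerTorsion_le_annihilator_smul_top` `L[℘] ⊆ Ann(℘)·L` for `L` free over `T`          (S)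
* A≤  `congruenceIdeal_le_span_pairing`  `η ⊆ (⟨x, y⟩)` if `L[℘] ⊆ ⟨x, y⟩_O`, `y` unimodular (S)
* B1  `map_kerTorsion_le`                `ψ(L[℘]) ⊆ L'[℘']`                                  (XS)
* B2  `mem_range_of_smul_mem_range`      adjoint of a surjection has saturated range        (S)
* B3  `le_span_pair_of_finrank_le_two`   rank-2 + saturated pair spans                      (S)
* C   `pairing_transport`                `⟨ψx, ψy⟩' = π(c)·⟨x, y⟩` if `φ ∘ ψ = c`            (XS)
* D   `congruenceIdeal_comp_le_span_mul` abstract DDT Thm. 3.36: `η' ⊆ (π c)·η`             (S given A–C)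

and ONE modular existence statement (`IharaEtaStep_of_selfDualData`, frame) feeding g7's
`IharaEtaStep`.  A≥, A0, A≤, B1, C are PROVED below (`lean check` rc 0); B2, B3, D and the frame are `sorry`
(sizes S).  Nothing here is registered; the lead / critic picks.
-/

set_option linter.dupNamespace false

noncomputable section

open Literature.RingTheory.CompleteIntersection

namespace Summit.ABC.ABC.Cruxes.FreyModularity.StubIdeas2g8

universe u v v' w w'

section SelfDual

variable {O : Type u} [CommRing O] {T : Type v} [CommRing T] [Algebra O T] (π : T →ₐ[O] O)
variable {L : Type w} [AddCommGroup L] [Module O L] [Module T L] [IsScalarTower O T L]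

/-- `L[℘]`, `℘ = ker π`: the elements of the `T`-module `L` killed by the augmentation ideal, as an
`O`-submodule (DDT p. 126 "`L[℘]`"). -/
abbrev kerTorsion : Submodule O L :=
  (Submodule.torsionBySet T L ((RingHom.ker π : Ideal T) : Set T)).restrictScalars O

/-- On `L[℘]` the algebra `T` acts through `π`: `t • y = π(t) • y`. [folklore] -/
theorem smul_eq_of_mem_kerTorsion {y : L} (hy : y ∈ kerTorsion π (L := L)) (t : T) :
    t • y = π t • y := by
  have hmem : t - algebraMap O T (π t) ∈ RingHom.ker π := sub_algebraMap_mem_ker π t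
  have h0 : (t - algebraMap O T (π t)) • y = 0 := by
    rw [Submodule.restrictScalars_mem, Submodule.mem_torsionBySet_iff] at hy
    exact hy ⟨_, hmem⟩
  rw [sub_smul, sub_eq_zero, algebraMap_smul] at h0
  exact h0

/-- **A≥** (XS; PROVED; DDT Lemma 4.17, the inclusion `O·det ⊆ η^d` read elementwise; Wiles (2.4)):
for a `T`-self-adjoint pairing, `⟨x, y⟩ ∈ η_π` whenever `x ∈ Ann_T(℘)·L` and `y ∈ L[℘]`
(`⟨g u, y⟩ = ⟨u, g y⟩ = π(g)⟨u, y⟩`, `π(g) ∈ η`).  No freeness, no perfectness.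
[cite: DarmonDiamondTaylor1995, Lemma 4.17 p. 126] -/
theorem pairing_mem_congruenceIdeal (B : L →ₗ[O] L →ₗ[O] O)
    (hB : ∀ (t : T) (u v : L), B (t • u) v = B u (t • v)) {x y : L}
    (hx : x ∈ (RingHom.ker π).annihilator • (⊤ : Submodule T L))
    (hy : y ∈ kerTorsion π (L := L)) :
    B x y ∈ congruenceIdeal π := by
  refine Submodule.smul_induction_on (p := fun x => B x y ∈ congruenceIdeal π) hx ?_ ?_
  · intro g hg u _
    rw [hB, smul_eq_of_mem_kerTorsion π hy g, map_smul, smul_eq_mul]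
    exact Ideal.mul_mem_right _ _ (apply_mem_congruenceIdeal π hg)
  · intro u v hu hv
    rw [map_add, LinearMap.add_apply]
    exact Ideal.add_mem _ hu hv

omit [Module O L] [IsScalarTower O T L] in
/-- **A0** (S; PROVED): for `L` free over `T`, `L[℘] ⊆ Ann_T(℘)·L` (coordinates of a `℘`-torsion vector
in a `T`-basis are killed by `℘`).  This is where multiplicity one (`L_Σ` free of rank 2 over
`T_Σ`, DDT Thm. 4.18 / Wiles Thm. 2.1 Cor. 1) enters — at the LOWER level only (DDT Remark 4.25).
[cite: DarmonDiamondTaylor1995, Lemma 4.17 p. 126 ("equality holds if `L` is free")] -/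
theorem kerTorsion_le_annihilator_smul_top [Module.Free T L] :
    Submodule.torsionBySet T L ((RingHom.ker π : Ideal T) : Set T) ≤
      (RingHom.ker π).annihilator • (⊤ : Submodule T L) := by
  intro y hy
  rw [Submodule.mem_torsionBySet_iff] at hy
  let b := Module.Free.chooseBasis T L
  rw [← b.linearCombination_repr y, Finsupp.linearCombination_apply, Finsupp.sum]
  refine Submodule.sum_mem _ fun i _ => Submodule.smul_mem_smul ?_ Submodule.mem_top
  rw [mem_annihilator_ker_iff]
  intro s hs
  have h := congrArg (fun v => b.repr v i) (hy ⟨s, by simpa only [SetLike.mem_coe, RingHom.mem_ker] using hs⟩)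
  simp only [map_smul, map_zero, Finsupp.smul_apply, Finsupp.zero_apply, smul_eq_mul] at h
  rw [mul_comm]
  exact h

/-- **A≤** (S; PROVED; DDT Lemma 4.17 / Cor. 4.19, the inclusion `η ⊆ (⟨x, y⟩)` read elementwise): if
every `℘`-torsion vector is an `O`-combination of `x, y`, `⟨y, y⟩ = 0` and `y` is unimodular
(`⟨z, y⟩ = 1` for some `z`), then `η_π ⊆ (⟨x, y⟩)`: for `t ∈ Ann(℘)`, `t z ∈ L[℘]`, so
`t z = αx + βy` and `π(t) = π(t)⟨z, y⟩ = ⟨t z, y⟩ = α⟨x, y⟩`.  No freeness of `L` over `T`.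
[cite: DarmonDiamondTaylor1995, Cor. 4.19 p. 127] -/
theorem congruenceIdeal_le_span_pairing (B : L →ₗ[O] L →ₗ[O] O)
    (hB : ∀ (t : T) (u v : L), B (t • u) v = B u (t • v)) {x y : L}
    (hy : y ∈ kerTorsion π (L := L)) (hyy : B y y = 0) (hz : ∃ z, B z y = 1)
    (hspan : kerTorsion π (L := L) ≤ Submodule.span O {x, y}) :
    congruenceIdeal π ≤ Ideal.span {B x y} := by
  intro a ha
  obtain ⟨t, ht, rfl⟩ := (mem_congruenceIdeal_iff π).1 ha
  obtain ⟨z, hz⟩ := hz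
  have htz : t • z ∈ kerTorsion π (L := L) := by
    rw [Submodule.restrictScalars_mem, Submodule.mem_torsionBySet_iff]
    rintro ⟨s, hs⟩
    have h0 : t * s = 0 :=
      (mem_annihilator_ker_iff π).1 ht s (by simpa only [SetLike.mem_coe, RingHom.mem_ker] using hs)
    change s • t • z = 0
    rw [← mul_smul, mul_comm, h0, zero_smul]
  obtain ⟨α, β, hαβ⟩ := Submodule.mem_span_pair.1 (hspan htz)
  have h1 : B (t • z) y = π t := by
    rw [hB, smul_eq_of_mem_kerTorsion π hy t, map_smul, smul_eq_mul, hz, mul_one]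
  have key : π t = α * B x y := by
    rw [← h1, ← hαβ]
    simp only [map_add, map_smul, LinearMap.add_apply, LinearMap.smul_apply, hyy, smul_eq_mul,
      mul_zero, add_zero]
  rw [key]
  exact Ideal.mul_mem_left _ _ (Ideal.mem_span_singleton_self _)

end SelfDual

section Transport

variable {O : Type u} [CommRing O] {T : Type v} [CommRing T] [Algebra O T] (π : T →ₐ[O] O)
variable {T' : Type v'} [CommRing T'] [Algebra O T'] (f : T' →ₐ[O] T)
variable {L : Type w} [AddCommGroup L] [Module O L] [Module T L] [IsScalarTower O T L]
variable {L' : Type w'} [AddCommGroup L'] [Module O L'] [Module T' L'] [IsScalarTower O T' L']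

/-- **B1** (XS; PROVED): an `O`-linear `ψ : L → L'`, equivariant along `f : T' → T`
(`ψ(f(t') z) = t' ψ(z)`), maps `L[ker π]` into `L'[ker (π ∘ f)]`. [folklore] -/
theorem map_kerTorsion_le (ψ : L →ₗ[O] L') (hψ : ∀ (t' : T') (z : L), ψ (f t' • z) = t' • ψ z) :
    (kerTorsion π (L := L)).map ψ ≤ kerTorsion (π.comp f) (L := L') := by
  rintro _ ⟨z, hz, rfl⟩
  rw [SetLike.mem_coe, Submodule.restrictScalars_mem, Submodule.mem_torsionBySet_iff] at hz
  rw [Submodule.restrictScalars_mem, Submodule.mem_torsionBySet_iff]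
  rintro ⟨s', hs'⟩
  have hs : f s' ∈ RingHom.ker π := by
    simpa only [SetLike.mem_coe, RingHom.mem_ker, AlgHom.coe_comp, Function.comp_apply] using hs'
  change s' • ψ z = 0
  rw [← hψ s' z, hz ⟨f s', hs⟩, map_zero]

/-- **B2** (S; Wiles Lemma 2.5 "ξ has torsion-free cokernel", in adjoint form): if `φ : L' ↠ L`
is surjective and `ψ` is its adjoint (`⟨φ w, z⟩ = ⟨w, ψ z⟩'`) for a pairing `⟨·,·⟩` on `L` that is
perfect on the right (`z ↦ ⟨·, z⟩` bijective onto the dual; `L` finite free over the domain `O`),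
then the range of `ψ` is saturated in the torsion-free `L'`: `a w ∈ ψ(L)`, `a ≠ 0` ⇒ `w ∈ ψ(L)`.
[cite: Wiles1995Annals, Lemma 2.5 and proof of Prop. 2.4, pp. 494–496] -/
theorem mem_range_of_smul_mem_range [IsDomain O] [Module.Free O L] [Module.Finite O L]
    [NoZeroSMulDivisors O L'] (B : L →ₗ[O] L →ₗ[O] O) (B' : L' →ₗ[O] L' →ₗ[O] O)
    (φ : L' →ₗ[O] L) (ψ : L →ₗ[O] L') (hadj : ∀ (w : L') (z : L), B (φ w) z = B' w (ψ z))
    (hφ : Function.Surjective φ) (hperf : Function.Bijective B.flip) {a : O} (ha : a ≠ 0)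
    {w : L'} (hw : a • w ∈ LinearMap.range ψ) : w ∈ LinearMap.range ψ := by
  sorry

/-- **B3** (S, pure linear algebra over a domain): inside a finitely generated `O`-module `P` of
rank `≤ 2`, a linearly independent pair `u, v ∈ P` whose span is saturated in `P` spans `P`
(any `m ∈ P` satisfies `c m = a u + b v` with `c ≠ 0`). [folklore] -/
theorem le_span_pair_of_finrank_le_two [IsDomain O] {M : Type w} [AddCommGroup M] [Module O M]
    (P : Submodule O M) [Module.Finite O P] {u v : M} (hu : u ∈ P) (hv : v ∈ P)
    (hli : LinearIndependent O ![u, v]) (hP : Module.finrank O P ≤ 2)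
    (hsat : ∀ (a : O) (m : M), a ≠ 0 → m ∈ P → a • m ∈ Submodule.span O {u, v} →
      m ∈ Submodule.span O {u, v}) :
    P ≤ Submodule.span O {u, v} := by
  sorry

/-- **C** (XS; PROVED; Wiles p. 496 "`u₁⁻¹ ∘ ξ̂ ∘ ξ ∘ u₂ = −q⁻¹(q−1)(T_q² − q(1+q)²)`", DDT p. 133
"`φ_T φ'_T = −p⁻²(p−1)(T_p² − (p+1)²)`"): if the composite `φ ∘ ψ` is the action of `c ∈ T`,
then `⟨ψ x, ψ y⟩' = π(c)·⟨x, y⟩` for `y ∈ L[℘]`. [cite: DarmonDiamondTaylor1995, §4.4 p. 133] -/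
theorem pairing_transport (B : L →ₗ[O] L →ₗ[O] O) (B' : L' →ₗ[O] L' →ₗ[O] O)
    (hB : ∀ (t : T) (u v : L), B (t • u) v = B u (t • v))
    (φ : L' →ₗ[O] L) (ψ : L →ₗ[O] L') (hadj : ∀ (w : L') (z : L), B (φ w) z = B' w (ψ z))
    {c : T} (hc : ∀ z : L, φ (ψ z) = c • z) {x y : L} (hy : y ∈ kerTorsion π (L := L)) :
    B' (ψ x) (ψ y) = π c * B x y := by
  rw [← hadj (ψ x) y, hc x, hB, smul_eq_of_mem_kerTorsion π hy c, map_smul, smul_eq_mul]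

/-- **D — abstract DDT Thm. 3.36 / Wiles Prop. 2.4** (S given A–C): augmented algebras
`π : T → O`, `π' = π ∘ f : T' → O` with `f` surjective; self-adjoint pairings on a `T`-module `L`
(finite free over the domain `O`, FREE over `T`, right-perfect) and a torsion-free `T'`-module `L'`
(`⟨w, w⟩' = 0`); an adjoint pair `φ : L' ↠ L` (SURJECTIVE — Ihara), `ψ : L → L'`
(`f`-equivariant) with `φ ∘ ψ = c ∈ T`; `L[℘] = ⟨x, y⟩_O` with `x, y` independent and `y`
unimodular; `rank_O L'[℘'] ≤ 2` (multiplicity one over `K` at the upper level).  Then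
`η_{π'} ⊆ (π c)·η_π`.  Chain: A≤ at the upper level for `ψx, ψy` (B1–B3 give
`L'[℘'] ⊆ ⟨ψx, ψy⟩`, unimodularity of `ψy` from `φ` surjective) = `(π(c)⟨x, y⟩)` (C)
`⊆ (π c)·η_π` (A0, A≥). [cite: DarmonDiamondTaylor1995, Thm. 3.36 p. 98, §4.4 pp. 125–133] -/
theorem congruenceIdeal_comp_le_span_mul [IsDomain O] [Module.Free O L] [Module.Finite O L]
    [Module.Free T L] [NoZeroSMulDivisors O L'] [IsNoetherian O L'] (hf : Function.Surjective f)
    (B : L →ₗ[O] L →ₗ[O] O) (B' : L' →ₗ[O] L' →ₗ[O] O)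
    (hB : ∀ (t : T) (u v : L), B (t • u) v = B u (t • v))
    (hB' : ∀ (t' : T') (u v : L'), B' (t' • u) v = B' u (t' • v)) (hB'alt : ∀ w : L', B' w w = 0)
    (hperf : Function.Bijective B.flip)
    (φ : L' →ₗ[O] L) (ψ : L →ₗ[O] L') (hadj : ∀ (w : L') (z : L), B (φ w) z = B' w (ψ z))
    (hψ : ∀ (t' : T') (z : L), ψ (f t' • z) = t' • ψ z) (hφ : Function.Surjective φ)
    {c : T} (hc : ∀ z : L, φ (ψ z) = c • z)
    {x y : L} (hli : LinearIndependent O ![x, y])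
    (hspan : kerTorsion π (L := L) = Submodule.span O {x, y}) (hz : ∃ z, B z y = 1)
    (hrank : Module.finrank O ↥(kerTorsion (π.comp f) (L := L')) ≤ 2) :
    congruenceIdeal (π.comp f) ≤ Ideal.span {π c} * congruenceIdeal π := by
  sorry

end Transport

/-! ## Frame: the modular data ⇒ g7's `IharaEtaStep` (one prime `q ≠ p` at a time) -/

section Frame

open scoped NumberField
open Field IsDedekindDomain Rat.HeightOneSpectrum
open Literature.NumberTheory.GaloisRepresentations Literature.NumberTheory.Automorphic

variable (p : ℕ) (k : ℤ) {O : Type} [CommRing O] [TopologicalSpace O]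
  (Ō : Type v) [CommRing Ō] [IsLocalRing Ō] [TopologicalSpace Ō] [Algebra O Ō]
  (ρ : FramedGaloisRep ℚ O 2)

/-- **Self-dual Hecke data at `(S, S' = S ∪ {q})`** — the MODULAR input of the Σ-step, as one
existence statement over the tree's `T_S = heckeAlgebraOfTypeSigma`, its `augmentation` and
`restrict : T_S' →ₐ[O] T_S` (named-fact size L/XL; contents = DDT (4.4.2) `L_T = (T_ℓ J₀(N_Σ) ⊗ O)_𝔪`
with the `w`-twisted Weil pairing + Prop. 4.7 `T_Σ ≅ T_𝔪` + Thm. 4.18 freeness + Lemma 4.24 Ihara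
surjectivity + the composite `φ_T φ'_T = unit · (q−1)(T_q² − (q+1)²)` + Lemma 3.27 (b) surjectivity
of `restrict`): there are an `O`-finite-free `T_S`-free self-dual module `L`, a torsion-free
alternating self-dual `T_S'`-module `L'` of `℘'`-rank `≤ 2`, and an Ihara pair `(φ, ψ)` whose
composite is `u · (q − 1)(T_σ² − (q + 1)²)` for a unit `u ∈ O`.
[cite: DarmonDiamondTaylor1995, §4.4 (4.4.2), Thm. 4.18, Lemma 4.24, p. 133; Wiles1995Annals, Prop. 2.6] -/
def SelfDualHeckeData (S : Set ℕ) (q : ℕ) (σ : absoluteGaloisGroup ℚ) : Prop :=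
  let TS := heckeAlgebraOfTypeSigma p k Ō ρ S
  let TS' := heckeAlgebraOfTypeSigma p k Ō ρ (insert q S)
  let πS := heckeAlgebraOfTypeSigma.augmentation p k Ō ρ S
  let f := heckeAlgebraOfTypeSigma.restrict p k Ō ρ (Set.subset_insert q S)
  Function.Surjective f ∧
  ∃ (L : Type) (_ : AddCommGroup L) (_ : Module O L) (_ : Module TS L) (_ : IsScalarTower O TS L)
    (_ : Module.Free O L) (_ : Module.Finite O L) (_ : Module.Free TS L)
    (L' : Type) (_ : AddCommGroup L') (_ : Module O L') (_ : Module TS' L')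
    (_ : IsScalarTower O TS' L') (_ : NoZeroSMulDivisors O L') (_ : IsNoetherian O L')
    (B : L →ₗ[O] L →ₗ[O] O) (B' : L' →ₗ[O] L' →ₗ[O] O) (φ : L' →ₗ[O] L) (ψ : L →ₗ[O] L')
    (x y : L) (u : Oˣ) (c : TS),
    (∀ (t : TS) (a b : L), B (t • a) b = B a (t • b)) ∧
    (∀ (t' : TS') (a b : L'), B' (t' • a) b = B' a (t' • b)) ∧ (∀ w : L', B' w w = 0) ∧
    Function.Bijective B.flip ∧
    (∀ (w : L') (z : L), B (φ w) z = B' w (ψ z)) ∧ (∀ (t' : TS') (z : L), ψ (f t' • z) = t' • ψ z) ∧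
    Function.Surjective φ ∧ (∀ z : L, φ (ψ z) = c • z) ∧
    πS c = (u : O) * ((((q : ℕ) : O) - 1) * ((FramedRep.trace ρ σ) ^ 2 - (((q : ℕ) : O) + 1) ^ 2)) ∧
    LinearIndependent O ![x, y] ∧ kerTorsion πS (L := L) = Submodule.span O {x, y} ∧
    (∃ z, B z y = 1) ∧ Module.finrank O ↥(kerTorsion (πS.comp f) (L := L')) ≤ 2

/-- **Frame** (S given D): self-dual Hecke data at `(S, S ∪ {q})` for the good Frobenius `σ` at
`q` give the `q`-step of g7's `IharaEtaStep`:
`η_{S ∪ {q}} ⊆ ((q−1)((tr ρ σ)² − (q+1)²)) · η_S` (`augmentation_comp_restrict` identifies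
`η_{S'}` with `congruenceIdeal (π_S ∘ restrict)`; the unit `u` is absorbed by `Ideal.span`).
[cite: DarmonDiamondTaylor1995, Thm. 3.36 p. 98] -/
theorem sigmaCongruenceIdeal_insert_le_of_selfDualData [IsDomain O] (S : Set ℕ) (q : ℕ)
    (σ : absoluteGaloisGroup ℚ) (h : SelfDualHeckeData p k Ō ρ S q σ) :
    sigmaCongruenceIdeal p k Ō ρ (insert q S) ≤
      Ideal.span {(((q : ℕ) : O) - 1) * ((FramedRep.trace ρ σ) ^ 2 - (((q : ℕ) : O) + 1) ^ 2)} *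
        sigmaCongruenceIdeal p k Ō ρ S := by
  sorry

end Frame

end Summit.ABC.ABC.Cruxes.FreyModularity.StubIdeas2g8

end
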